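import Mathlib

/-!
# Crux `FeketeSOS.SublinearShadow` (stmt-ValiantsHypothesis-14990), line `Sketch`
# (window / DFT de-bordering), stub `stub_primRoot`: a cheap primitive root of unity

The `Π^v`-layer of a two-variable identity over an algebraically closed field `K` of
characteristic `p` is extracted by a discrete Fourier transform over the `m`-th roots of unity,
which needs a primitive `m`-th root of unity `ζ ∈ K` with `m > 2v`, `m` invertible in `K`, and
`m ≤ 2v + 2` (cost control).

Proof idea: take `m := 2v+1` if `¬ p ∣ 2v+1`, else `m := 2v+2` (a prime cannot divide two
consecutive integers, as it would then divide `1`).  Invertibility `(m : K) ≠ 0 ↔ ¬ p ∣ m` is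
`CharP.cast_eq_zero_iff`.  Given `NeZero (m : K)`, a separably (in particular algebraically)
closed field has a primitive `m`-th root of unity: Mathlib's instance
`IsSepClosed.hasEnoughRootsOfUnity` together with `HasEnoughRootsOfUnity.exists_primitiveRoot`.
-/

namespace Summit.ValiantsHypothesis.ValiantsHypothesis.Theorems.SublinearShadowSketch

open Polynomial Finset

-- `Summit.ValiantsHypothesis.ValiantsHypothesis.…` is the tree's mandated single-conjunct layout (Sub = Summit).
set_option linter.dupNamespace false

/-- A prime `p` does not divide both `n` and `n + 1`. [folklore] -/
theorem prr_not_dvd_succ_of_dvd {p n : ℕ} (hp : p.Prime) (h : p ∣ n) : ¬ p ∣ n + 1 := by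
  intro h'
  exact hp.ne_one (Nat.dvd_one.mp ((Nat.dvd_add_right h).mp h'))

/-- In characteristic `p` (prime), for every `v` one of the two integers `2v+1`, `2v+2` is
nonzero in `K`; so there is `m` with `2v < m ≤ 2v+2` and `(m : K) ≠ 0`. [folklore] -/
theorem prr_exists_window (p : ℕ) [hp : Fact p.Prime] (K : Type) [Field K] [CharP K p] (v : ℕ) :
    ∃ m : ℕ, 2 * v < m ∧ m ≤ 2 * v + 2 ∧ (m : K) ≠ 0 := by
  by_cases h : p ∣ 2 * v + 1
  · refine ⟨2 * v + 2, by omega, le_rfl, ?_⟩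
    rw [Ne, CharP.cast_eq_zero_iff K p]
    exact prr_not_dvd_succ_of_dvd hp.out h
  · refine ⟨2 * v + 1, by omega, by omega, ?_⟩
    rw [Ne, CharP.cast_eq_zero_iff K p]
    exact h

/-- **A cheap primitive root of unity.**  Over an algebraically closed field `K` of prime
characteristic `p`, for every `v : ℕ` there are `m` with `2v < m ≤ 2v + 2`, `(m : K) ≠ 0`, and a
primitive `m`-th root of unity `ζ ∈ K`. [folklore] -/
theorem stub_primRoot (p : ℕ) [Fact p.Prime] (K : Type) [Field K] [CharP K p] [IsAlgClosed K] (v : ℕ) :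
    ∃ (m : ℕ) (ζ : K), 2 * v < m ∧ m ≤ 2 * v + 2 ∧ (m : K) ≠ 0 ∧ IsPrimitiveRoot ζ m := by
  obtain ⟨m, h1, h2, h3⟩ := prr_exists_window p K v
  haveI : NeZero (m : K) := ⟨h3⟩
  obtain ⟨ζ, hζ⟩ := HasEnoughRootsOfUnity.exists_primitiveRoot K m
  exact ⟨m, ζ, h1, h2, h3, hζ⟩

end Summit.ValiantsHypothesis.ValiantsHypothesis.Theorems.SublinearShadowSketch
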